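import Mathlib.Probability.Martingale.OptionalStopping
import Mathlib.MeasureTheory.Integral.Layercake
import Mathlib.Analysis.SpecialFunctions.Pow.Integral
import Mathlib.MeasureTheory.Integral.MeanInequalities
import Mathlib.Algebra.Order.Group.PosPart
import Literature.Probability.Process.DoobMaximalIneq
import HarnessLib

/-!
# Doob's `L²` inequality `E[sup M²] ≤ 4 E[M_N²]` (strong form), discrete and continuous time

`Literature.Probability.Process.DoobMaximalIneq` has the *weak-type* (tail) form of Doob's
inequality in continuous time. The Itô-integral layer (the `L²` maximal estimate
`E[sup_{s ≤ t} (∫₀ˢ H dB)²] ≤ 4 E ∫₀ᵗ H² ds`, Revuz–Yor IX (2.1)) needs the *strong* `L²` form: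

* `Literature.Probability.Process.doob_lintegral_sup_sq_le` — discrete time: for a nonnegative square-integrable
  submartingale `f` and `S_N = max_{k ≤ N} f_k`, `∫⁻ S_N² ≤ 4 ∫⁻ f_N²` (Mathlib's strong grid
  inequality `ε μ{S_N ≥ ε} ≤ E[f_N; S_N ≥ ε]` (`MeasureTheory.maximal_ineq`), the layer-cake
  formula and the Cauchy–Schwarz inequality);
* `Literature.Probability.Process.doob_lintegral_sup_sq_le_of_martingale` — the same for `|M|`, `M` a square-integrable
  discrete martingale;
* `Literature.Probability.Process.doob_lintegral_iSup_sq_le_of_continuous` — **continuous time**: for a square-integrable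
  martingale `M` indexed by `ℝ≥0` with a.s. continuous paths,
  `∫⁻ ⨆_{s ≤ t} M_s² ≤ 4 ∫⁻ M_t²` (dyadic grids, path continuity, monotone convergence).

All statements are in `ℝ≥0∞` (`∫⁻` of `ENNReal.ofReal`), the form consumed downstream; they
hold for finite measures.

## References

* D. Revuz, M. Yor, *Continuous Martingales and Brownian Motion* (3rd ed., 1999), Ch. II,
  Thm (1.7) (Doob's `Lᵖ` inequality, `‖X*‖_p ≤ (p/(p-1)) sup_t ‖X_t‖_p`, here `p = 2`; continuous
  time "by considering countable dense subsets").
* J. L. Doob, *Stochastic Processes* (1953), Ch. VII, Thm 3.4.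
-/

open MeasureTheory ProbabilityTheory Filter Finset
open scoped NNReal ENNReal Topology

namespace Literature.Probability.Process

variable {Ω : Type*} {m : MeasurableSpace Ω} {μ : Measure Ω}

/-! ### An `ℝ≥0∞` cancellation lemma -/

/-- If `X ≤ 2 · Y^{1/2} · X^{1/2}` in `ℝ≥0∞` and `X < ∞` then `X ≤ 4 Y` (the algebra behind every
`Lᵖ` Doob inequality, `p = 2`). [folklore] -/
theorem le_four_mul_of_le_two_mul_sqrt {X Y : ℝ≥0∞} (hX : X ≠ ∞)
    (h : X ≤ 2 * Y ^ (1 / 2 : ℝ) * X ^ (1 / 2 : ℝ)) : X ≤ 4 * Y := by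
  set a : ℝ≥0∞ := X ^ (1 / 2 : ℝ) with ha
  set b : ℝ≥0∞ := Y ^ (1 / 2 : ℝ) with hb
  have hXa : X = a ^ 2 := by
    rw [ha, ← ENNReal.rpow_two, ← ENNReal.rpow_mul]; norm_num
  have hYb : Y = b ^ 2 := by
    rw [hb, ← ENNReal.rpow_two, ← ENNReal.rpow_mul]; norm_num
  rcases eq_or_ne a 0 with ha0 | ha0
  · rw [hXa, ha0]; simp
  have hatop : a ≠ ∞ := by
    rw [ha]; exact ENNReal.rpow_ne_top_of_nonneg (by norm_num) hX
  have hab : a ≤ 2 * b := by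
    have h' : a * a ≤ 2 * b * a := by
      calc a * a = a ^ 2 := (sq a).symm
        _ = X := hXa.symm
        _ ≤ 2 * b * a := h
    exact (ENNReal.mul_le_mul_iff_left ha0 hatop).mp h'
  calc X = a ^ 2 := hXa
    _ ≤ (2 * b) ^ 2 := by gcongr
    _ = 4 * Y := by rw [hYb]; ring

/-! ### Discrete time -/

section Discrete

variable {𝒢 : Filtration ℕ m} {f : ℕ → Ω → ℝ}

/-- **Doob's `L²` inequality, discrete time**: for a nonnegative submartingale `f` with
`f_k ∈ L²` and `S_N = max_{k ≤ N} f_k`, `∫⁻ S_N² dμ ≤ 4 ∫⁻ f_N² dμ`.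
Proof: layer cake `∫⁻ S² = 2 ∫₀^∞ t μ{S ≥ t} dt`, the strong maximal inequality
`t μ{S ≥ t} ≤ ∫_{S ≥ t} f_N` (Mathlib `maximal_ineq`), Tonelli `∫₀^∞ ∫_{S ≥ t} f_N dt = ∫ f_N S`
and Cauchy–Schwarz; `S ∈ L²` because `S ≤ ∑_{k ≤ N} f_k`.
Revuz–Yor, *Continuous Martingales and Brownian Motion* (1999), Ch. II, Thm (1.7) (discrete
case, `p = 2`); Doob (1953), Ch. VII, Thm 3.4. [cite: RevuzYor1999, Ch. II Thm (1.7)] -/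
theorem doob_lintegral_sup_sq_le [IsFiniteMeasure μ] (hsub : Submartingale f 𝒢 μ)
    (hnonneg : 0 ≤ f) (hL2 : ∀ k, MemLp (f k) 2 μ) (N : ℕ) :
    ∫⁻ ω, ENNReal.ofReal
        (((range (N + 1)).sup' nonempty_range_add_one fun k ↦ f k ω) ^ 2) ∂μ ≤
      4 * ∫⁻ ω, ENNReal.ofReal (f N ω ^ 2) ∂μ := by
  set S : Ω → ℝ := fun ω ↦ (range (N + 1)).sup' nonempty_range_add_one fun k ↦ f k ω with hS
  have hfm : ∀ k, Measurable (f k) := fun k ↦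
    ((hsub.stronglyAdapted k).mono (𝒢.le k)).measurable
  have hSm : Measurable S := Finset.measurable_range_sup'' fun k _ ↦ hfm k
  have hS0 : ∀ ω, 0 ≤ S ω := fun ω ↦
    (hnonneg 0 ω).trans (Finset.le_sup' (fun k ↦ f k ω) (by simp))
  have hfN0 : ∀ ω, 0 ≤ f N ω := fun ω ↦ hnonneg N ω
  -- Step 1: layer cake
  have hLC : ∫⁻ ω, ENNReal.ofReal (S ω ^ 2) ∂μ =
      ENNReal.ofReal 2 * ∫⁻ t in Set.Ioi 0, μ {ω | t ≤ S ω} * ENNReal.ofReal t := by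
    have h := lintegral_rpow_eq_lintegral_meas_le_mul μ (f := S) (ae_of_all _ hS0)
      hSm.aemeasurable (p := 2) two_pos
    simp only [Real.rpow_two] at h
    rw [h]
    congr 1
    refine setLIntegral_congr_fun measurableSet_Ioi fun t _ ↦ ?_
    norm_num
  -- Step 2: the strong maximal inequality at each level `t > 0`
  have hmax : ∀ t : ℝ, 0 < t →
      μ {ω | t ≤ S ω} * ENNReal.ofReal t ≤ ∫⁻ ω in {ω | t ≤ S ω}, ENNReal.ofReal (f N ω) ∂μ := by
    intro t ht
    have h := maximal_ineq hsub hnonneg (ε := t.toNNReal) N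
    have hcoe : ((t.toNNReal : ℝ≥0) : ℝ) = t := Real.coe_toNNReal _ ht.le
    simp only [hcoe] at h
    rw [mul_comm, show ENNReal.ofReal t = ((t.toNNReal : ℝ≥0) : ℝ≥0∞) from rfl]
    refine h.trans (le_of_eq ?_)
    exact ofReal_integral_eq_lintegral_ofReal (hsub.integrable N).integrableOn
      (ae_of_all _ fun ω ↦ hfN0 ω)
  -- Step 3: Tonelli
  have hTon : ∫⁻ t in Set.Ioi 0, ∫⁻ ω in {ω | t ≤ S ω}, ENNReal.ofReal (f N ω) ∂μ =
      ∫⁻ ω, ENNReal.ofReal (f N ω) * ENNReal.ofReal (S ω) ∂μ := by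
    have h1 : ∀ t : ℝ, ∫⁻ ω in {ω | t ≤ S ω}, ENNReal.ofReal (f N ω) ∂μ =
        ∫⁻ ω, {p : ℝ × Ω | p.1 ≤ S p.2}.indicator (fun p ↦ ENNReal.ofReal (f N p.2)) (t, ω) ∂μ := by
      intro t
      rw [← lintegral_indicator (measurableSet_le measurable_const hSm)]
      refine lintegral_congr fun ω ↦ ?_
      by_cases hω : t ≤ S ω
      · rw [Set.indicator_of_mem (show ω ∈ {ω | t ≤ S ω} from hω),
          Set.indicator_of_mem (show (t, ω) ∈ {p : ℝ × Ω | p.1 ≤ S p.2} from hω)]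
      · rw [Set.indicator_of_notMem (show ω ∉ {ω | t ≤ S ω} from hω),
          Set.indicator_of_notMem (show (t, ω) ∉ {p : ℝ × Ω | p.1 ≤ S p.2} from hω)]
    simp_rw [h1]
    have hFm : Measurable fun p : ℝ × Ω ↦
        {p : ℝ × Ω | p.1 ≤ S p.2}.indicator (fun p ↦ ENNReal.ofReal (f N p.2)) p :=
      (ENNReal.measurable_ofReal.comp ((hfm N).comp measurable_snd)).indicator
        (measurableSet_le measurable_fst (hSm.comp measurable_snd))
    rw [lintegral_lintegral_swap (by exact hFm.aemeasurable)]
    refine lintegral_congr fun ω ↦ ?_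
    have h2 : ∀ t : ℝ, {p : ℝ × Ω | p.1 ≤ S p.2}.indicator (fun p ↦ ENNReal.ofReal (f N p.2))
        (t, ω) = (Set.Iic (S ω)).indicator (fun _ ↦ ENNReal.ofReal (f N ω)) t := by
      intro t
      by_cases ht : t ≤ S ω
      · rw [Set.indicator_of_mem (show (t, ω) ∈ {p : ℝ × Ω | p.1 ≤ S p.2} from ht),
          Set.indicator_of_mem (Set.mem_Iic.2 ht)]
      · rw [Set.indicator_of_notMem (show (t, ω) ∉ {p : ℝ × Ω | p.1 ≤ S p.2} from ht),
          Set.indicator_of_notMem (fun h ↦ ht (Set.mem_Iic.1 h))]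
    simp_rw [h2]
    rw [lintegral_indicator_const measurableSet_Iic, Measure.restrict_apply measurableSet_Iic,
      Set.inter_comm, Set.Ioi_inter_Iic, Real.volume_Ioc, sub_zero, mul_comm]
  -- Step 4: Cauchy–Schwarz
  have hCS : ∫⁻ ω, ENNReal.ofReal (f N ω) * ENNReal.ofReal (S ω) ∂μ ≤
      (∫⁻ ω, ENNReal.ofReal (f N ω ^ 2) ∂μ) ^ (1 / 2 : ℝ) *
        (∫⁻ ω, ENNReal.ofReal (S ω ^ 2) ∂μ) ^ (1 / 2 : ℝ) := by
    have h := ENNReal.lintegral_mul_le_Lp_mul_Lq μ Real.HolderConjugate.two_two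
      (f := fun ω ↦ ENNReal.ofReal (f N ω)) (g := fun ω ↦ ENNReal.ofReal (S ω))
      (ENNReal.measurable_ofReal.comp (hfm N)).aemeasurable
      (ENNReal.measurable_ofReal.comp hSm).aemeasurable
    simp only [Pi.mul_apply, ENNReal.rpow_two] at h
    simp_rw [ENNReal.ofReal_pow (hfN0 _), ENNReal.ofReal_pow (hS0 _)]
    exact h
  -- Step 5: `S ∈ L²`
  have hXfin : ∫⁻ ω, ENNReal.ofReal (S ω ^ 2) ∂μ ≠ ∞ := by
    have hsum : MemLp (fun ω ↦ ∑ k ∈ range (N + 1), f k ω) 2 μ := by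
      have := memLp_finsetSum' (range (N + 1)) (fun k _ ↦ hL2 k)
      convert this using 1
      ext ω
      simp [Finset.sum_apply]
    have hint : Integrable (fun ω ↦ (∑ k ∈ range (N + 1), f k ω) ^ 2) μ := hsum.integrable_sq
    refine (lt_of_le_of_lt (lintegral_mono fun ω ↦ ENNReal.ofReal_le_ofReal ?_)
      hint.lintegral_lt_top).ne
    have hSle : S ω ≤ ∑ k ∈ range (N + 1), f k ω :=
      Finset.sup'_le _ _ fun k hk ↦ Finset.single_le_sum (fun j _ ↦ hnonneg j ω) hk
    exact pow_le_pow_left₀ (hS0 ω) hSle 2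
  -- Step 6: assemble
  refine le_four_mul_of_le_two_mul_sqrt hXfin ?_
  calc ∫⁻ ω, ENNReal.ofReal (S ω ^ 2) ∂μ
      = ENNReal.ofReal 2 * ∫⁻ t in Set.Ioi 0, μ {ω | t ≤ S ω} * ENNReal.ofReal t := hLC
    _ ≤ ENNReal.ofReal 2 * ∫⁻ t in Set.Ioi 0,
          ∫⁻ ω in {ω | t ≤ S ω}, ENNReal.ofReal (f N ω) ∂μ := by
        gcongr ENNReal.ofReal 2 * ?_
        exact setLIntegral_mono' measurableSet_Ioi fun t ht ↦ hmax t ht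
    _ = ENNReal.ofReal 2 * ∫⁻ ω, ENNReal.ofReal (f N ω) * ENNReal.ofReal (S ω) ∂μ := by rw [hTon]
    _ ≤ ENNReal.ofReal 2 * ((∫⁻ ω, ENNReal.ofReal (f N ω ^ 2) ∂μ) ^ (1 / 2 : ℝ) *
          (∫⁻ ω, ENNReal.ofReal (S ω ^ 2) ∂μ) ^ (1 / 2 : ℝ)) := by gcongr
    _ = 2 * (∫⁻ ω, ENNReal.ofReal (f N ω ^ 2) ∂μ) ^ (1 / 2 : ℝ) *
          (∫⁻ ω, ENNReal.ofReal (S ω ^ 2) ∂μ) ^ (1 / 2 : ℝ) := by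
        rw [ENNReal.ofReal_ofNat, mul_assoc]

/-- The absolute value of a martingale is a nonnegative submartingale (`|M| = M⁺ + (-M)⁺`, both
submartingales by Mathlib's `Submartingale.pos`; no conditional Jensen inequality is needed).
Revuz–Yor, *Continuous Martingales and Brownian Motion* (1999), Ch. II, §1, after Prop. (1.2).
[folklore] -/
theorem _root_.MeasureTheory.Martingale.submartingale_abs {ι : Type*} [Preorder ι]
    {ℱ : Filtration ι m} {M : ι → Ω → ℝ} [IsFiniteMeasure μ] (hM : Martingale M ℱ μ) :
    Submartingale (fun i ω ↦ |M i ω|) ℱ μ := by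
  have h1 : Submartingale (M⁺) ℱ μ := hM.submartingale.pos
  have h2 : Submartingale ((-M)⁺) ℱ μ := hM.neg.submartingale.pos
  have h := h1.add h2
  have heq : (M⁺ + (-M)⁺) = fun i ω ↦ |M i ω| := by
    ext i ω
    simp only [Pi.add_apply, Pi.posPart_apply, Pi.neg_apply]
    rw [posPart_neg, posPart_add_negPart]
  rwa [heq] at h

/-- **Doob's `L²` inequality for discrete martingales**: `∫⁻ (max_{k ≤ N} |M_k|)² ≤ 4 ∫⁻ M_N²`
for a square-integrable martingale `M`.
Revuz–Yor, *Continuous Martingales and Brownian Motion* (1999), Ch. II, Thm (1.7) and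
Cor. (1.6); Doob (1953), Ch. VII, Thm 3.4. [cite: RevuzYor1999, Ch. II Thm (1.7)] -/
theorem doob_lintegral_sup_sq_le_of_martingale [IsFiniteMeasure μ] {M : ℕ → Ω → ℝ}
    (hM : Martingale M 𝒢 μ) (hL2 : ∀ k, MemLp (M k) 2 μ) (N : ℕ) :
    ∫⁻ ω, ENNReal.ofReal
        (((range (N + 1)).sup' nonempty_range_add_one fun k ↦ |M k ω|) ^ 2) ∂μ ≤
      4 * ∫⁻ ω, ENNReal.ofReal (M N ω ^ 2) ∂μ := by
  have h := doob_lintegral_sup_sq_le hM.submartingale_abs (fun k ω ↦ abs_nonneg _)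
    (fun k ↦ (hL2 k).abs) N
  simpa only [sq_abs] using h

end Discrete

/-! ### Continuous time -/

section Continuous

/-- Dyadic lower approximations `⌊s 2ⁿ⌋ / 2ⁿ → s` in `ℝ≥0`. [folklore] -/
theorem tendsto_nat_floor_div_two_pow (s : ℝ≥0) :
    Tendsto (fun n : ℕ ↦ ((⌊(s : ℝ) * 2 ^ n⌋₊ : ℕ) : ℝ≥0) / 2 ^ n) atTop (𝓝 s) := by
  rw [← NNReal.tendsto_coe]
  have hle : ∀ n : ℕ, ((((⌊(s : ℝ) * 2 ^ n⌋₊ : ℕ) : ℝ≥0) / 2 ^ n : ℝ≥0) : ℝ) ≤ s := by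
    intro n
    push_cast
    rw [div_le_iff₀ (pow_pos two_pos n)]
    exact Nat.floor_le (by positivity)
  have hge : ∀ n : ℕ, (s : ℝ) - 1 / 2 ^ n ≤ ((((⌊(s : ℝ) * 2 ^ n⌋₊ : ℕ) : ℝ≥0) / 2 ^ n : ℝ≥0) : ℝ) := by
    intro n
    push_cast
    rw [le_div_iff₀ (pow_pos two_pos n), sub_mul, div_mul_cancel₀ _ (pow_ne_zero n two_ne_zero)]
    exact (Nat.sub_one_lt_floor _).le
  have h0 : Tendsto (fun n : ℕ ↦ (s : ℝ) - 1 / 2 ^ n) atTop (𝓝 (s : ℝ)) := by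
    have : Tendsto (fun n : ℕ ↦ (1 / 2 : ℝ) ^ n) atTop (𝓝 0) :=
      tendsto_pow_atTop_nhds_zero_of_lt_one (by norm_num) (by norm_num)
    simpa using (tendsto_const_nhds (x := (s : ℝ))).sub this
  exact tendsto_of_tendsto_of_tendsto_of_le_of_le h0 tendsto_const_nhds hge hle

/-- **Doob's `L²` inequality in continuous time** for square-integrable martingales with a.s.
continuous paths, indexed by `ℝ≥0`: for every `t`,
`∫⁻ ⨆_{s ≤ t} M_s² dμ ≤ 4 ∫⁻ M_t² dμ`.
Proof: the discrete inequality along the nested dyadic grids `k/2ⁿ ∧ t`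
(`doob_lintegral_sup_sq_le_of_martingale`), monotone convergence in `n`, and, on continuous
paths, `⨆_{s ≤ t} M_s² ≤ ⨆ₙ max_k M_{k/2ⁿ ∧ t}²` (every `s ≤ t` is a limit of grid points).
Revuz–Yor, *Continuous Martingales and Brownian Motion* (1999), Ch. II, Thm (1.7) (from the
discrete case "by considering countable dense subsets"); Doob (1953), Ch. VII, §11.
[cite: RevuzYor1999, Ch. II Thm (1.7)] -/
theorem doob_lintegral_iSup_sq_le_of_continuous {𝓕 : Filtration ℝ≥0 m} {M : ℝ≥0 → Ω → ℝ}
    [IsFiniteMeasure μ] (hM : Martingale M 𝓕 μ) (hL2 : ∀ s, MemLp (M s) 2 μ)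
    (hcont : ∀ᵐ ω ∂μ, Continuous (M · ω)) (t : ℝ≥0) :
    ∫⁻ ω, ⨆ s ∈ Set.Iic t, ENNReal.ofReal (M s ω ^ 2) ∂μ ≤
      4 * ∫⁻ ω, ENNReal.ofReal (M t ω ^ 2) ∂μ := by
  -- the nested dyadic grids `τ n k = (k / 2ⁿ) ∧ t`, `k ≤ N n = (⌊t⌋ + 1) 2ⁿ`
  let τ : ℕ → ℕ → ℝ≥0 := fun n k ↦ min ((k : ℝ≥0) / 2 ^ n) t
  let N : ℕ → ℕ := fun n ↦ (⌊(t : ℝ)⌋₊ + 1) * 2 ^ n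
  have hτmono : ∀ n, Monotone (τ n) := fun n k l hkl ↦ by
    simp only [τ]
    gcongr
  have hτle : ∀ n k, τ n k ≤ t := fun n k ↦ min_le_right _ _
  have hτN : ∀ n, τ n (N n) = t := by
    intro n
    simp only [τ, N]
    refine min_eq_right ?_
    rw [Nat.cast_mul, Nat.cast_pow, Nat.cast_ofNat, mul_div_assoc,
      div_self (pow_ne_zero n two_ne_zero), mul_one, ← NNReal.coe_le_coe]
    push_cast
    exact (Nat.lt_floor_add_one (t : ℝ)).le
  -- the grid maxima
  let G : ℕ → Ω → ℝ≥0∞ := fun n ω ↦ ENNReal.ofReal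
    (((range (N n + 1)).sup' nonempty_range_add_one fun k ↦ |M (τ n k) ω|) ^ 2)
  have hMm : ∀ s, Measurable (M s) := fun s ↦ ((hM.stronglyAdapted s).mono (𝓕.le s)).measurable
  have hGm : ∀ n, Measurable (G n) := fun n ↦
    ENNReal.measurable_ofReal.comp ((Finset.measurable_range_sup'' fun k _ ↦
      continuous_abs.measurable.comp (hMm _)).pow_const 2)
  -- Step 1: the discrete bound on each grid
  have hgrid : ∀ n, ∫⁻ ω, G n ω ∂μ ≤ 4 * ∫⁻ ω, ENNReal.ofReal (M t ω ^ 2) ∂μ := by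
    intro n
    have h := doob_lintegral_sup_sq_le_of_martingale (hM.reindex_nat (hτmono n))
      (fun k ↦ hL2 (τ n k)) (N n)
    simpa only [G, hτN n] using h
  -- Step 2: the grid maxima increase with `n` (nested grids: `τ (n+1) (2k) = τ n k`)
  have hGmono : Monotone G := by
    refine monotone_nat_of_le_succ fun n ω ↦ ?_
    simp only [G]
    refine ENNReal.ofReal_le_ofReal (pow_le_pow_left₀ ?_ ?_ 2)
    · exact (abs_nonneg _).trans
        (Finset.le_sup' (fun k ↦ |M (τ n k) ω|) (mem_range.2 (Nat.zero_lt_succ _)))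
    · refine Finset.sup'_le _ _ fun k hk ↦ ?_
      have hk' : 2 * k ∈ range (N (n + 1) + 1) := by
        have hN : N (n + 1) = 2 * N n := by simp only [N, pow_succ]; ring
        simp only [mem_range] at hk ⊢
        rw [hN]; omega
      have hτeq : τ (n + 1) (2 * k) = τ n k := by
        simp only [τ]
        congr 1
        rw [Nat.cast_mul, Nat.cast_ofNat, pow_succ]
        field_simp
      calc |M (τ n k) ω| = |M (τ (n + 1) (2 * k)) ω| := by rw [hτeq]
        _ ≤ (range (N (n + 1) + 1)).sup' nonempty_range_add_one
              fun j ↦ |M (τ (n + 1) j) ω| :=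
            Finset.le_sup' (fun j ↦ |M (τ (n + 1) j) ω|) hk'
  -- Step 3: on continuous paths the supremum over `[0, t]` is below the supremum of grid maxima
  have hle : ∀ ω, Continuous (M · ω) →
      ⨆ s ∈ Set.Iic t, ENNReal.ofReal (M s ω ^ 2) ≤ ⨆ n, G n ω := by
    intro ω hω
    refine iSup₂_le fun s hs ↦ ?_
    -- grid points `τ n (k n) → s` with `k n = ⌊s 2ⁿ⌋ ≤ N n`
    let k : ℕ → ℕ := fun n ↦ ⌊(s : ℝ) * 2 ^ n⌋₊
    have hks : ∀ n, ((k n : ℕ) : ℝ≥0) / 2 ^ n ≤ s := by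
      intro n
      rw [div_le_iff₀ (pow_pos two_pos n), ← NNReal.coe_le_coe]
      push_cast
      exact Nat.floor_le (by positivity)
    have hτk : ∀ n, τ n (k n) = ((k n : ℕ) : ℝ≥0) / 2 ^ n := fun n ↦
      min_eq_left ((hks n).trans hs)
    have hkN : ∀ n, k n ∈ range (N n + 1) := by
      intro n
      simp only [mem_range, k, N]
      have h1 : ((⌊(s : ℝ) * 2 ^ n⌋₊ : ℕ) : ℝ) ≤ (s : ℝ) * 2 ^ n := Nat.floor_le (by positivity)
      have h2 : (s : ℝ) * 2 ^ n < (⌊(t : ℝ)⌋₊ + 1) * 2 ^ n := by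
        have hst : (s : ℝ) ≤ t := by exact_mod_cast hs
        have := Nat.lt_floor_add_one (t : ℝ)
        have h2n : (0 : ℝ) < 2 ^ n := pow_pos two_pos n
        nlinarith
      have h3 : ((⌊(s : ℝ) * 2 ^ n⌋₊ : ℕ) : ℝ) < (((⌊(t : ℝ)⌋₊ + 1) * 2 ^ n : ℕ) : ℝ) := by
        push_cast
        linarith
      exact_mod_cast (show (⌊(s : ℝ) * 2 ^ n⌋₊ : ℕ) < (⌊(t : ℝ)⌋₊ + 1) * 2 ^ n + 1 from
        Nat.lt_succ_of_lt (by exact_mod_cast h3))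
    have htend : Tendsto (fun n ↦ ENNReal.ofReal (M (τ n (k n)) ω ^ 2)) atTop
        (𝓝 (ENNReal.ofReal (M s ω ^ 2))) := by
      have h1 : Tendsto (fun n ↦ τ n (k n)) atTop (𝓝 s) := by
        simp only [hτk]
        exact tendsto_nat_floor_div_two_pow s
      exact ENNReal.continuous_ofReal.continuousAt.tendsto.comp
        (((hω.tendsto s).comp h1).pow 2)
    refine le_of_tendsto' htend fun n ↦ ?_
    calc ENNReal.ofReal (M (τ n (k n)) ω ^ 2) ≤ G n ω := by
          simp only [G]
          refine ENNReal.ofReal_le_ofReal ?_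
          rw [← sq_abs (M (τ n (k n)) ω)]
          refine pow_le_pow_left₀ (abs_nonneg _) ?_ 2
          exact Finset.le_sup' (fun j ↦ |M (τ n j) ω|) (hkN n)
      _ ≤ ⨆ n, G n ω := le_iSup (fun n ↦ G n ω) n
  -- Step 4: assemble
  have hae : ∀ᵐ ω ∂μ, ⨆ s ∈ Set.Iic t, ENNReal.ofReal (M s ω ^ 2) ≤ ⨆ n, G n ω :=
    hcont.mono fun ω hω ↦ hle ω hω
  calc ∫⁻ ω, ⨆ s ∈ Set.Iic t, ENNReal.ofReal (M s ω ^ 2) ∂μ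
      ≤ ∫⁻ ω, ⨆ n, G n ω ∂μ := lintegral_mono_ae hae
    _ = ⨆ n, ∫⁻ ω, G n ω ∂μ := lintegral_iSup hGm hGmono
    _ ≤ 4 * ∫⁻ ω, ENNReal.ofReal (M t ω ^ 2) ∂μ := iSup_le hgrid

end Continuous

end Literature.Probability.Process
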